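import Literature.NumberTheory.ConnesConsani2021.ProlateProjections
import Literature.Analysis.OperatorTheory.HermitianKernelOperator
import Literature.Analysis.Fourier.FractalUncertaintyLemma32
import Literature.Analysis.FunctionSpaces.PlancherelL1L2
import Mathlib.Analysis.SpecialFunctions.Integrals.Basic
import Mathlib.Analysis.Fourier.FourierTransformDeriv
import Mathlib.Analysis.Calculus.Deriv.Star
import Literature.Analysis.OperatorTheory.CompactSelfAdjointEigenbasis
import HarnessLib

/-!
# The sinc operator `𝒫₁𝒫̂₁𝒫₁` on `L²([−1,1])`: compactness, band-limited energy, trivial kernel,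
# smooth eigenfunctions (module (a) of the discharge of `CC2021_sec4_xi_complete`)

LINE 1 — FRAMING: RH-FREE classical analysis (Slepian–Pollak 1961 §III: the time- and band-limiting
operator on `[−1,1]`); cell rh-crit, corpus C1, seat t10, row O10 (lead R51: t10 modules (a)+(c), t3 module
(b) `ProlateCommutation`); bears_on: W-C/W-P (apex (A), K1 binders hii/h46i/hsp via
`CC2021_sec4_xi_complete`).  WHAT THIS IS NOT: any claim about RH — nothing here bears on the truth of RH.

Topic `NumberTheory/ConnesConsani2021`; namespace `Literature.NumberTheory.ConnesConsani2021`.  Two plumbing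
definitions (`sincKernel`, `prolateXiI`) and theorems; no named fact, no instance, no `sorry`.

Connes–Consani 2021, §4 p. 16: the restricted Fourier projections `𝒫₁` (cutoff to `[−1,1]`) and
`𝒫̂₁ = 𝔽⁻¹𝒫₁𝔽` give on `L²([−1,1])` the operator `K := 𝒫₁𝒫̂₁𝒫₁`,
`(Kφ)(y) = ∫_{−1}^{1} κ(y−x)φ(x) dx`, `κ(v) = ∫_{−1}^{1} e^{2πiξv} dξ = sin(2πv)/(πv)` (Mathlib's kernel
`e^{−2πixξ}` = CC's eq. (13); Slepian–Pollak's `sin c(y−x)/(π(y−x))` at `c = 2π`), whose eigenfunctions are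
the prolate spheroidal wave functions ((prolateeq)–(cosalphan1), p. 16).  This file supplies the
OPERATOR-THEORETIC half of the completeness statement "the `ξ_n` form an orthonormal basis of the range of
`𝒫₁`" (`CC2021_sec4_xi_complete`, Slepian–Pollak 1961 §III / Rokhlin–Xiao 2007 Thm 3 / Osipov 2013 Thm 1):

* `sincKernel` (continuous, bounded by `2`, even, real, Hermitian as a difference kernel;
  `sincKernel_sub_eq_integral`: `κ(y−x) = ∫_{−1}^{1}e^{2πiξy}e^{−2πiξx}dξ`), `prolateXiI n` (the even prolate
  function `h_{2n,1}` as an element of `L²([−1,1])`);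
* `exists_sincOp` — `K` EXISTS as a bounded operator on `L²([−1,1]) = Lp ℂ 2 (volume.restrict [−1,1])`
  with the a.e. kernel action, and is COMPACT and SELF-ADJOINT (bounded continuous Hermitian kernel on a
  finite measure space: the tree's `exists_hermitianKernelOp_rclike`, Reed–Simon I Thm VI.23); all later
  statements are about ANY `K` with the a.e. kernel action `hK`;
* `integral_sincKernel_mul_eq`, **`inner_sincOp_eq_integral_normSq`** — the quadratic form is the
  band-limited energy: `⟪φ, Kφ⟫ = ∫_{−1}^{1} |𝓕(1_{[−1,1]}φ)(ξ)|² dξ` ("`⟨ξ|PP̂Pξ⟩ = ‖P̂Pξ‖²`", Prop. 4.5 (iii));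
* **`eq_zero_of_sincOp_eq_zero` — `ker K = 0`**: the Fourier transform of the compactly supported
  `1_{[−1,1]}φ` extends to an entire function (tree `Literature.Analysis.Fourier.differentiable_fourierLaplaceInv`),
  vanishes on `(−1,1)` when `Kφ = 0`, hence identically (identity theorem), so `φ = 0` by Plancherel
  (tree `integral_norm_sq_fourierIntegral_eq`) — "these two projections have zero intersection"
  (CC 2023 §3 p. 11);
* `finiteDimensional_eigenspace_sincOp` (Mathlib, compact operators), `mem_eigenspace_sincOp_iff`;
* **`exists_smooth_repr_of_sincOp_eq_smul`** (and the `C²` form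
  `exists_contDiff_two_repr_of_sincOp_eq_smul`) — REGULARITY IS FREE: an eigenvector with eigenvalue
  `ν ≠ 0` has a representative `g ∈ C^∞(ℝ)` (band-limited: `g = ν⁻¹∫_{−1}^{1}e^{2πiξ·}𝓕(1_Iφ)(ξ)dξ`,
  Mathlib `Real.contDiff_fourier`) satisfying `ν g(y) = ∫_{−1}^{1}κ(y−x)g(x)dx` pointwise on `[−1,1]` —
  the input of the commutation step `[𝐖, K] = 0` (module (b), seat t3);
* `measurePreserving_neg_Icc`, **`sincOp_comp_reflection`** (`K` commutes with `(Rφ)(x) = φ(−x)`: even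
  kernel), `exists_smooth_even_repr_of_sincOp_eq_smul` (even eigenvectors have even smooth representatives);
* **`inner_eigenvector_eq_zero`, `eq_zero_of_even_of_orthogonal_prolateXiI`,
  `CC2021_sec4_xi_complete_of_commutation`** — the ASSEMBLY, stated modulo the hypothesis `hstep3` (=
  the theorem module (b) `ProlateCommutation` delivers: every a.e.-even eigenvector with eigenvalue `ν ≠ 0`
  lies in `span {prolateXiI n}`): split an eigenvector into `½(S+RS) ∈ E_ν` even (⊥ `f` by `hstep3`) and
  `½(S−RS)` odd (⊥ the even `f`); expand `Kf` in a Hilbert eigenbasis of `K` (tree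
  `exists_hilbertBasis_eigenvectors_of_isSelfAdjoint`) to get `Kf = 0`, so `f = 0` (`ker K = 0`); transport
  `range 𝒫₁ ⊂ L²(ℝ) ↔ L²([−1,1])` (`inner_prolateXiI_restrict`).  With (b) landed, the discharge
  `CC2021_sec4_xi_complete_holds` is `CC2021_sec4_xi_complete_of_commutation <(b)'s theorem>` (module (c));
* `integral_sincKernel_mul` (function-level `K = F^*F`: `∫κ(y−x)φ(x)dx = ∫_{−1}^{1}e^{2πiξy}∫_{−1}^{1}e^{−2πiξx}φ(x)dx dξ`
  for `φ` integrable on `[−1,1]`), `sincKernel_eq_integral_cos` (`κ(v) = ∫_{−1}^{1}cos(2πξv)dξ`) — requested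
  by module (b);
* **`exists_entire_even_repr_of_sincOp_eq_smul`** — even eigenvectors are restrictions of even ENTIRE functions
  (identity theorem ⇒ finitely many zeros in `[−1,1]` unless `S = 0`), and `re_im_of_entire_eigenfunction`
  (real and imaginary parts again satisfy the eigen-equation, are smooth, and are restrictions of entire
  functions: finitely many zeros or identically zero) — the zero-count input of the identification step of (b).

## References

* A. Connes, C. Consani, *Weil positivity and trace formula, the archimedean place*, Selecta Math. 27
  (2021), §4 p. 16 (prolateeq)–(cosalphan1), Prop. 4.5 (arXiv:2006.13771 p0016). [ConnesConsani2021]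
* A. Connes, C. Consani, *Spectral triples and ζ-cycles*, Enseign. Math. 69 (2023), §3 p. 11
  (arXiv:2106.01715 p0011:L18). [ConnesConsani2023]
* D. Slepian, H. O. Pollak, Bell System Tech. J. 40 (1961) 43–63, §III. [SlepianPollak1961]
* M. Reed, B. Simon, *Methods of Modern Mathematical Physics I*, Thm VI.16, VI.23. [ReedSimonI1980]
-/

noncomputable section

open MeasureTheory Complex Set Filter
open scoped Real ComplexConjugate InnerProductSpace Topology FourierTransform

namespace Literature.NumberTheory.ConnesConsani2021

open Literature.Analysis.OperatorTheory Literature.Analysis.Fourier Literature.Analysis.FunctionSpaces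

/-! ### The sinc kernel `κ(v) = ∫_{-1}^{1} e^{2πiξv} dξ` -/

/-- **The sinc kernel** of `𝒫₁𝒫̂₁𝒫₁` on `L²([−1,1])`: `κ(v) := ∫_{−1}^{1} e^{2πiξv} dξ`
(`= sin(2πv)/(πv)`, `κ(0) = 2`): with Mathlib's Fourier kernel `e^{−2πixξ}` (CC's eq. (13)),
`(𝒫̂₁𝒫₁ξ)(y) = ∫_{−1}^{1} κ(y − x) ξ(x) dx` for `y ∈ [−1,1]` — the operator whose eigenfunctions are the
prolate functions (Slepian–Pollak's `∫_{−1}^{1} (sin c(y−x))/(π(y−x)) ψ(x) dx = λψ(y)`, `c = 2π`).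
[cite: ConnesConsani2021, §4 p. 16 eq. (prolateeq)–(cosalphan1) (arXiv p0016:L13–L34); SlepianPollak1961, §III] -/
def sincKernel (v : ℝ) : ℂ := ∫ ξ in (-1 : ℝ)..1, cexp (2 * π * I * ξ * v)

/-- **The even prolate function `h_{2n,1}` as an element of `L²([−1,1])`** (restriction of the tree's
`prolateXiFun n = prolateFun n`, CC's `ξ_n` up to `√2`). [cite: ConnesConsani2021, Prop. 4.5 (i) §4 p. 16 (arXiv p0016:L50)] -/
def prolateXiI (n : ℕ) : Lp ℂ 2 (volume.restrict (Icc (-1 : ℝ) 1)) :=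
  ((memLp_prolateXiFun n).restrict (Icc (-1 : ℝ) 1)).toLp _

/-- The sinc kernel is continuous. [cite: ConnesConsani2021, §4 p. 16 eq. (prolateeq)–(cosalphan1) (arXiv p0016:L13–L34); SlepianPollak1961, §III] -/
theorem continuous_sincKernel : Continuous sincKernel := by
  unfold sincKernel
  exact intervalIntegral.continuous_parametric_intervalIntegral_of_continuous' (by fun_prop) _ _

/-- `|κ(v)| ≤ 2`. [cite: ConnesConsani2021, §4 p. 16 eq. (prolateeq)–(cosalphan1) (arXiv p0016:L13–L34); SlepianPollak1961, §III] -/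
theorem norm_sincKernel_le (v : ℝ) : ‖sincKernel v‖ ≤ 2 := by
  unfold sincKernel
  have h := intervalIntegral.norm_integral_le_of_norm_le_const (a := (-1 : ℝ)) (b := 1) (C := 1)
    (f := fun ξ : ℝ => cexp (2 * π * I * ξ * v)) (fun ξ _ => by
      rw [show (2 * π * I * ξ * v : ℂ) = ((2 * π * ξ * v : ℝ) : ℂ) * I by push_cast; ring,
        Complex.norm_exp_ofReal_mul_I])
  norm_num at h
  exact h

/-- `κ(−v) = conj κ(v)`. [cite: ConnesConsani2021, §4 p. 16 eq. (prolateeq)–(cosalphan1) (arXiv p0016:L13–L34); SlepianPollak1961, §III] -/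
theorem sincKernel_neg_eq_conj (v : ℝ) : sincKernel (-v) = conj (sincKernel v) := by
  unfold sincKernel
  rw [intervalIntegral.integral_of_le (by norm_num : (-1 : ℝ) ≤ 1),
    intervalIntegral.integral_of_le (by norm_num : (-1 : ℝ) ≤ 1), ← integral_conj]
  refine setIntegral_congr_fun measurableSet_Ioc (fun ξ _ => ?_)
  rw [← Complex.exp_conj]
  congr 1
  simp only [map_mul, Complex.conj_ofReal, Complex.conj_I, map_ofNat, Complex.ofReal_neg]
  ring

/-- `κ` is even: `κ(−v) = κ(v)` (substitute `ξ ↦ −ξ`). [cite: ConnesConsani2021, §4 p. 16 eq. (prolateeq)–(cosalphan1) (arXiv p0016:L13–L34); SlepianPollak1961, §III] -/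
theorem sincKernel_neg (v : ℝ) : sincKernel (-v) = sincKernel v := by
  unfold sincKernel
  have h := intervalIntegral.integral_comp_neg (a := (-1 : ℝ)) (b := 1)
    (f := fun ξ : ℝ => cexp (2 * π * I * ξ * v))
  rw [show -(-1 : ℝ) = 1 by norm_num] at h
  rw [← h]
  refine intervalIntegral.integral_congr (fun ξ _ => ?_)
  show cexp (2 * π * I * ξ * (-v : ℝ)) = cexp (2 * π * I * (-ξ : ℝ) * v)
  congr 1; push_cast; ring

/-- `κ` is real: `conj κ(v) = κ(v)`. [cite: ConnesConsani2021, §4 p. 16 eq. (prolateeq)–(cosalphan1) (arXiv p0016:L13–L34); SlepianPollak1961, §III] -/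
theorem conj_sincKernel (v : ℝ) : conj (sincKernel v) = sincKernel v := by
  rw [← sincKernel_neg_eq_conj, sincKernel_neg]

/-- The kernel `(y, x) ↦ κ(y − x)` is Hermitian. [cite: ConnesConsani2021, §4 p. 16 eq. (prolateeq)–(cosalphan1) (arXiv p0016:L13–L34); SlepianPollak1961, §III] -/
theorem sincKernel_sub_hermitian (y x : ℝ) : sincKernel (y - x) = conj (sincKernel (x - y)) := by
  rw [← sincKernel_neg_eq_conj, neg_sub]

/-! ### The operator `K = 𝒫₁𝒫̂₁𝒫₁` on `L²([−1,1])`: existence, compactness, self-adjointness -/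

/-- **The sinc operator exists as a compact self-adjoint operator on `L²([−1,1])`** with
`(Kφ)(y) = ∫_{−1}^{1} κ(y−x) φ(x) dx` a.e. and `⟪ψ, Kφ⟫ = ∫ ψ̄(y) ∫ κ(y−x)φ(x) dx dy` (bounded continuous
Hermitian kernel on a finite measure space: the tree's `exists_hermitianKernelOp_rclike`; "the
operator `𝒫_λ𝒫̂_λ𝒫_λ` … admits [a discrete spectrum]", CC 2023 §3 / Slepian–Pollak).
[cite: ConnesConsani2021, §4 p. 16 eq. (cosalphan1) (arXiv p0016:L29–L34); SlepianPollak1961, §III] -/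
theorem exists_sincOp :
    ∃ K : Lp ℂ 2 (volume.restrict (Icc (-1 : ℝ) 1)) →L[ℂ] Lp ℂ 2 (volume.restrict (Icc (-1 : ℝ) 1)),
      (∀ φ : Lp ℂ 2 (volume.restrict (Icc (-1 : ℝ) 1)),
        (K φ : ℝ → ℂ) =ᵐ[volume.restrict (Icc (-1 : ℝ) 1)]
          fun y => ∫ x in Icc (-1 : ℝ) 1, sincKernel (y - x) * (φ : ℝ → ℂ) x) ∧
      IsSelfAdjoint K ∧ IsCompactOperator K ∧
      ∀ ψ φ : Lp ℂ 2 (volume.restrict (Icc (-1 : ℝ) 1)),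
        ⟪ψ, K φ⟫_ℂ = ∫ y in Icc (-1 : ℝ) 1, conj ((ψ : ℝ → ℂ) y) *
          ∫ x in Icc (-1 : ℝ) 1, sincKernel (y - x) * (φ : ℝ → ℂ) x :=
  exists_hermitianKernelOp_rclike (𝕜 := ℂ) (μ := volume.restrict (Icc (-1 : ℝ) 1))
    (K := fun y x : ℝ => sincKernel (y - x))
    (continuous_sincKernel.comp (continuous_fst.sub continuous_snd)).stronglyMeasurable
    (fun y x => norm_sincKernel_le (y - x)) (fun y x => sincKernel_sub_hermitian y x)

/-! ### `⟪φ, Kφ⟫ = ∫_{-1}^{1} |𝓕(1_{[−1,1]}φ)(ξ)|² dξ` and `ker K = 0` -/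

section Kernel

variable {K : Lp ℂ 2 (volume.restrict (Icc (-1 : ℝ) 1)) →L[ℂ] Lp ℂ 2 (volume.restrict (Icc (-1 : ℝ) 1))}

/-- The zero extension `1_{[−1,1]}φ` of `φ ∈ L²([−1,1])` is integrable on `ℝ`. [cite: ConnesConsani2021, §4 p. 16 eq. (prolateeq)–(cosalphan1) (arXiv p0016:L13–L34); SlepianPollak1961, §III] -/
theorem integrable_indicator_coeFn (φ : Lp ℂ 2 (volume.restrict (Icc (-1 : ℝ) 1))) :
    Integrable ((Icc (-1 : ℝ) 1).indicator (φ : ℝ → ℂ)) := by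
  rw [integrable_indicator_iff measurableSet_Icc]
  exact (Lp.memLp φ).integrable one_le_two

/-- The zero extension `1_{[−1,1]}φ` of `φ ∈ L²([−1,1])` is in `L²(ℝ)`. [cite: ConnesConsani2021, §4 p. 16 eq. (prolateeq)–(cosalphan1) (arXiv p0016:L13–L34); SlepianPollak1961, §III] -/
theorem memLp_indicator_coeFn (φ : Lp ℂ 2 (volume.restrict (Icc (-1 : ℝ) 1))) :
    MemLp ((Icc (-1 : ℝ) 1).indicator (φ : ℝ → ℂ)) 2 volume :=
  (memLp_indicator_iff_restrict measurableSet_Icc).2 (Lp.memLp φ)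

/-- The Fourier transform of the zero extension as an integral over `[−1,1]`:
`𝓕(1_Iφ)(ξ) = ∫_{−1}^{1} e^{−2πixξ} φ(x) dx`. [cite: ConnesConsani2021, §4 p. 16 eq. (prolateeq)–(cosalphan1) (arXiv p0016:L13–L34); SlepianPollak1961, §III] -/
theorem fourier_indicator_coeFn_eq (φ : Lp ℂ 2 (volume.restrict (Icc (-1 : ℝ) 1))) (ξ : ℝ) :
    𝓕 ((Icc (-1 : ℝ) 1).indicator (φ : ℝ → ℂ)) ξ =
      ∫ x in Icc (-1 : ℝ) 1, cexp (-(2 * π * I * ξ * x)) * (φ : ℝ → ℂ) x := by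
  rw [Real.fourier_real_eq_integral_exp_smul, ← integral_indicator measurableSet_Icc]
  refine integral_congr_ae (Eventually.of_forall fun x => ?_)
  simp only [smul_eq_mul]
  by_cases hx : x ∈ Icc (-1 : ℝ) 1
  · rw [indicator_of_mem hx, indicator_of_mem hx]
    congr 1; push_cast; ring
  · rw [indicator_of_notMem hx, indicator_of_notMem hx, mul_zero]

/-- `‖𝓕(1_Iφ)(ξ)‖ ≤ ∫_{−1}^{1}|φ|`. [folklore] -/
private theorem norm_fourier_indicator_le (φ : Lp ℂ 2 (volume.restrict (Icc (-1 : ℝ) 1))) (ξ : ℝ) :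
    ‖𝓕 ((Icc (-1 : ℝ) 1).indicator (φ : ℝ → ℂ)) ξ‖ ≤
      ∫ x, ‖(Icc (-1 : ℝ) 1).indicator (φ : ℝ → ℂ) x‖ :=
  VectorFourier.norm_fourierIntegral_le_integral_norm _ _ _ _ _

/-- `𝓕(1_Iφ)` is continuous. [folklore] -/
private theorem continuous_fourier_indicator (φ : Lp ℂ 2 (volume.restrict (Icc (-1 : ℝ) 1))) :
    Continuous (𝓕 ((Icc (-1 : ℝ) 1).indicator (φ : ℝ → ℂ))) :=
  VectorFourier.fourierIntegral_continuous Real.continuous_fourierChar (by exact continuous_inner)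
    (integrable_indicator_coeFn φ)

/-- **Step 1**: `∫_{−1}^{1} κ(y−x)φ(x) dx = ∫_{−1}^{1} e^{2πiξy} 𝓕(1_Iφ)(ξ) dξ` (Fubini on `[−1,1]²`).
[cite: ConnesConsani2021, §4 p. 16 eq. (cosalphan1) (arXiv p0016:L29–L34)] -/
theorem integral_sincKernel_mul_eq (φ : Lp ℂ 2 (volume.restrict (Icc (-1 : ℝ) 1))) (y : ℝ) :
    ∫ x in Icc (-1 : ℝ) 1, sincKernel (y - x) * (φ : ℝ → ℂ) x =
      ∫ ξ in Ioc (-1 : ℝ) 1, cexp (2 * π * I * ξ * y) *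
        𝓕 ((Icc (-1 : ℝ) 1).indicator (φ : ℝ → ℂ)) ξ := by
  have hφ : Integrable (fun x => (φ : ℝ → ℂ) x) (volume.restrict (Icc (-1 : ℝ) 1)) :=
    (Lp.memLp φ).integrable one_le_two
  -- unfold the kernel as an integral over `ξ ∈ Ioc (-1) 1`
  have h1 : ∀ x : ℝ, sincKernel (y - x) * (φ : ℝ → ℂ) x =
      ∫ ξ in Ioc (-1 : ℝ) 1, cexp (2 * π * I * ξ * (y - x)) * (φ : ℝ → ℂ) x := by
    intro x
    rw [sincKernel, intervalIntegral.integral_of_le (by norm_num : (-1 : ℝ) ≤ 1), ← integral_mul_const]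
    push_cast
    rfl
  simp_rw [h1]
  -- swap the order of integration
  have hint : Integrable (Function.uncurry fun (x ξ : ℝ) => cexp (2 * π * I * ξ * (y - x)) * (φ : ℝ → ℂ) x)
      ((volume.restrict (Icc (-1 : ℝ) 1)).prod (volume.restrict (Ioc (-1 : ℝ) 1))) := by
    change Integrable (fun z : ℝ × ℝ => cexp (2 * π * I * z.2 * (y - z.1)) * (φ : ℝ → ℂ) z.1) _
    have h2 : Integrable (fun z : ℝ × ℝ => (φ : ℝ → ℂ) z.1 * (1 : ℂ))
        ((volume.restrict (Icc (-1 : ℝ) 1)).prod (volume.restrict (Ioc (-1 : ℝ) 1))) :=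
      hφ.mul_prod (integrable_const (1 : ℂ))
    refine (h2.bdd_mul (c := 1) (f := fun z : ℝ × ℝ => cexp (2 * π * I * z.2 * (y - z.1)))
      (Continuous.aestronglyMeasurable (by fun_prop)) ?_).congr ?_
    · exact Eventually.of_forall fun z => by
        rw [show (2 * π * I * z.2 * (y - z.1) : ℂ) = ((2 * π * z.2 * (y - z.1) : ℝ) : ℂ) * I by
          push_cast; ring, Complex.norm_exp_ofReal_mul_I]
    · exact Eventually.of_forall fun z => by simp only [mul_one]
  rw [integral_integral_swap hint]
  refine integral_congr_ae (Eventually.of_forall fun ξ => ?_)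
  simp only []
  rw [fourier_indicator_coeFn_eq, ← integral_const_mul]
  refine integral_congr_ae (Eventually.of_forall fun x => ?_)
  simp only []
  rw [show (2 * π * I * ξ * (y - x) : ℂ) = 2 * π * I * ξ * y + -(2 * π * I * ξ * x) by ring,
    Complex.exp_add]
  ring

/-- **Step 2 — the quadratic form of `K` is the band-limited energy**:
`⟪φ, Kφ⟫ = ∫_{−1}^{1} |𝓕(1_Iφ)(ξ)|² dξ` for the sinc operator `K` (any operator with the a.e. kernel action).
[cite: ConnesConsani2021, Prop. 4.5 (iii) §4 p. 16 ("`⟨ξ|PP̂Pξ⟩ = ‖P̂Pξ‖²`", arXiv p0016:L56–L59)] -/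
theorem inner_sincOp_eq_integral_normSq
    (hK : ∀ φ : Lp ℂ 2 (volume.restrict (Icc (-1 : ℝ) 1)),
      (K φ : ℝ → ℂ) =ᵐ[volume.restrict (Icc (-1 : ℝ) 1)]
        fun y => ∫ x in Icc (-1 : ℝ) 1, sincKernel (y - x) * (φ : ℝ → ℂ) x)
    (φ : Lp ℂ 2 (volume.restrict (Icc (-1 : ℝ) 1))) :
    ⟪φ, K φ⟫_ℂ = ∫ ξ in Ioc (-1 : ℝ) 1,
      ((‖𝓕 ((Icc (-1 : ℝ) 1).indicator (φ : ℝ → ℂ)) ξ‖ ^ 2 : ℝ) : ℂ) := by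
  set F : ℝ → ℂ := 𝓕 ((Icc (-1 : ℝ) 1).indicator (φ : ℝ → ℂ)) with hF
  have hφ : Integrable (fun x => (φ : ℝ → ℂ) x) (volume.restrict (Icc (-1 : ℝ) 1)) :=
    (Lp.memLp φ).integrable one_le_two
  have hφc : Integrable (fun y => conj ((φ : ℝ → ℂ) y)) (volume.restrict (Icc (-1 : ℝ) 1)) :=
    hφ.mono (RCLike.continuous_conj.comp_aestronglyMeasurable hφ.aestronglyMeasurable)
      (Eventually.of_forall fun x => by rw [RCLike.norm_conj])
  have hFc : Continuous F := continuous_fourier_indicator φ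
  have hFb : ∀ ξ, ‖F ξ‖ ≤ ∫ x, ‖(Icc (-1 : ℝ) 1).indicator (φ : ℝ → ℂ) x‖ :=
    norm_fourier_indicator_le φ
  have hFi : Integrable F (volume.restrict (Ioc (-1 : ℝ) 1)) :=
    (hFc.integrableOn_Icc (a := -1) (b := 1)).mono_set Ioc_subset_Icc_self
  rw [inner_eq_integral_of_ae_kernel hK φ φ]
  simp_rw [integral_sincKernel_mul_eq φ]
  simp only [← hF]
  -- `∫_y conj φ(y) ∫_ξ e^{2πiξy} F(ξ) = ∫_ξ F(ξ) conj(∫_y e^{-2πiξy} φ(y))`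
  have hint : Integrable (Function.uncurry fun (y ξ : ℝ) =>
      conj ((φ : ℝ → ℂ) y) * (cexp (2 * π * I * ξ * y) * F ξ))
      ((volume.restrict (Icc (-1 : ℝ) 1)).prod (volume.restrict (Ioc (-1 : ℝ) 1))) := by
    change Integrable (fun z : ℝ × ℝ => conj ((φ : ℝ → ℂ) z.1) * (cexp (2 * π * I * z.2 * z.1) * F z.2)) _
    have h2 : Integrable (fun z : ℝ × ℝ => conj ((φ : ℝ → ℂ) z.1) * F z.2)
        ((volume.restrict (Icc (-1 : ℝ) 1)).prod (volume.restrict (Ioc (-1 : ℝ) 1))) :=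
      hφc.mul_prod hFi
    refine (h2.bdd_mul (c := 1) (f := fun z : ℝ × ℝ => cexp (2 * π * I * z.2 * z.1))
      (Continuous.aestronglyMeasurable (by fun_prop)) ?_).congr ?_
    · exact Eventually.of_forall fun z => by
        rw [show (2 * π * I * z.2 * z.1 : ℂ) = ((2 * π * z.2 * z.1 : ℝ) : ℂ) * I by push_cast; ring,
          Complex.norm_exp_ofReal_mul_I]
    · exact Eventually.of_forall fun z => by ring
  have e1 : ∀ y : ℝ, conj ((φ : ℝ → ℂ) y) * ∫ ξ in Ioc (-1 : ℝ) 1, cexp (2 * π * I * ξ * y) * F ξ =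
      ∫ ξ in Ioc (-1 : ℝ) 1, conj ((φ : ℝ → ℂ) y) * (cexp (2 * π * I * ξ * y) * F ξ) :=
    fun y => by rw [← integral_const_mul]
  simp_rw [e1]
  rw [integral_integral_swap hint]
  refine integral_congr_ae (Eventually.of_forall fun ξ => ?_)
  simp only []
  have e2 : ∫ y in Icc (-1 : ℝ) 1, conj ((φ : ℝ → ℂ) y) * (cexp (2 * π * I * ξ * y) * F ξ) =
      F ξ * conj (∫ y in Icc (-1 : ℝ) 1, cexp (-(2 * π * I * ξ * y)) * (φ : ℝ → ℂ) y) := by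
    rw [← integral_conj, ← integral_const_mul]
    refine integral_congr_ae (Eventually.of_forall fun y => ?_)
    simp only [map_mul]
    rw [← Complex.exp_conj]
    have : (starRingEnd ℂ) (-(2 * π * I * ξ * y)) = 2 * π * I * ξ * y := by
      simp only [map_neg, map_mul, Complex.conj_ofReal, Complex.conj_I, map_ofNat]; ring
    rw [this]; ring
  rw [e2, ← fourier_indicator_coeFn_eq, ← hF, Complex.mul_conj, Complex.normSq_eq_norm_sq,
    Complex.ofReal_pow]

/-- **`ker K = 0`: a function in `L²([−1,1])` killed by the sinc operator vanishes** ("the two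
projections `𝒫_λ`, `𝒫̂_λ` have zero intersection"; here: `⟪φ,Kφ⟫ = ∫_{−1}^{1}|𝓕(1_Iφ)|² = 0`, the
Fourier transform of the compactly supported `1_Iφ` extends to an entire function
(tree `differentiable_fourierLaplaceInv`) vanishing on `(−1,1)`, hence identically, and Plancherel).
[cite: ConnesConsani2023, §3 p. 11 ("these two projections have zero intersection", arXiv p0011:L18); ConnesConsani2021, §4 p. 16] -/
theorem eq_zero_of_sincOp_eq_zero
    (hK : ∀ φ : Lp ℂ 2 (volume.restrict (Icc (-1 : ℝ) 1)),
      (K φ : ℝ → ℂ) =ᵐ[volume.restrict (Icc (-1 : ℝ) 1)]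
        fun y => ∫ x in Icc (-1 : ℝ) 1, sincKernel (y - x) * (φ : ℝ → ℂ) x)
    {φ : Lp ℂ 2 (volume.restrict (Icc (-1 : ℝ) 1))} (h0 : K φ = 0) : φ = 0 := by
  set g : ℝ → ℂ := (Icc (-1 : ℝ) 1).indicator (φ : ℝ → ℂ) with hg
  set F : ℝ → ℂ := 𝓕 g with hF
  have hgi : Integrable g := integrable_indicator_coeFn φ
  have hFc : Continuous F := continuous_fourier_indicator φ
  -- `∫_{Ioc} ‖F‖² = 0`
  have h1 : ∫ ξ in Ioc (-1 : ℝ) 1, ‖F ξ‖ ^ 2 = 0 := by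
    have h := inner_sincOp_eq_integral_normSq hK φ
    change ⟪φ, K φ⟫_ℂ = ∫ ξ in Ioc (-1 : ℝ) 1, ((‖F ξ‖ ^ 2 : ℝ) : ℂ) at h
    rw [h0, inner_zero_right, integral_complex_ofReal] at h
    exact_mod_cast h.symm
  -- hence `F = 0` a.e. on `Ioc (-1) 1`, and by continuity on `Ioo (-1) 1`
  have hFi2 : IntegrableOn (fun ξ => ‖F ξ‖ ^ 2) (Ioc (-1 : ℝ) 1) :=
    ((hFc.norm.pow 2).integrableOn_Icc (a := -1) (b := 1)).mono_set Ioc_subset_Icc_self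
  have h2 : ∀ᵐ ξ ∂(volume.restrict (Ioc (-1 : ℝ) 1)), ‖F ξ‖ ^ 2 = 0 := by
    have := (integral_eq_zero_iff_of_nonneg_ae (Eventually.of_forall fun ξ => by positivity) hFi2).1 h1
    exact this
  have h3 : EqOn F 0 (Ioo (-1 : ℝ) 1) := by
    refine Measure.eqOn_open_of_ae_eq (μ := volume) ?_ isOpen_Ioo hFc.continuousOn continuousOn_const
    have h2' : ∀ᵐ ξ ∂(volume.restrict (Ioo (-1 : ℝ) 1)), ‖F ξ‖ ^ 2 = 0 :=
      ae_restrict_of_ae_restrict_of_subset Ioo_subset_Ioc_self h2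
    filter_upwards [h2'] with ξ hξ
    simpa using hξ
  -- the entire extension `G(z) = ∫ e^{2πizξ} g(ξ) dξ`, `G(-t) = F(t)`
  set G : ℂ → ℂ := fun z => ∫ ξ : ℝ, cexp (2 * π * I * z * ξ) * g ξ with hG
  have hGd : Differentiable ℂ G :=
    differentiable_fourierLaplaceInv hgi zero_le_one (fun ξ hξ => by
      rw [hg, indicator_of_notMem]
      rw [mem_Icc, not_and_or, not_le, not_le]
      rcases le_or_gt 0 ξ with h | h
      · right; rwa [abs_of_nonneg h] at hξ
      · left; rw [abs_of_neg h] at hξ; linarith)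
  have hGF : ∀ t : ℝ, G (-(t : ℂ)) = F t := by
    intro t
    rw [hF, Real.fourier_real_eq_integral_exp_smul]
    refine integral_congr_ae (Eventually.of_forall fun ξ => ?_)
    simp only [smul_eq_mul]
    congr 1; push_cast; ring
  -- `G` vanishes on the real segment `(-1, 1)`, hence identically
  have hG0 : ∀ z, G z = 0 := by
    have hA : AnalyticOnNhd ℂ G univ := hGd.differentiableOn.analyticOnNhd isOpen_univ
    have hfreq : ∃ᶠ z in 𝓝[≠] (0 : ℂ), G z = 0 := by
      -- along the sequence `z_n = -(1/(n+2))`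
      have hseq : Tendsto (fun n : ℕ => -((1 / ((n : ℝ) + 2) : ℝ) : ℂ)) atTop (𝓝[≠] (0 : ℂ)) := by
        refine tendsto_nhdsWithin_iff.2 ⟨?_, Eventually.of_forall fun n => ?_⟩
        · have h1 : Tendsto (fun n : ℕ => (1 / ((n : ℝ) + 2) : ℝ)) atTop (𝓝 0) := by
            have := tendsto_one_div_add_atTop_nhds_zero_nat (𝕜 := ℝ)
            refine (tendsto_one_div_add_atTop_nhds_zero_nat.comp (tendsto_add_atTop_nat 1)).congr fun n => ?_
            simp only [Function.comp]; push_cast; ring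
          have h2 : Tendsto (fun n : ℕ => ((1 / ((n : ℝ) + 2) : ℝ) : ℂ)) atTop (𝓝 0) := by
            have h := (Complex.continuous_ofReal.tendsto (0 : ℝ)).comp h1
            rw [Complex.ofReal_zero] at h
            exact h
          simpa using h2.neg
        · have hpos : (0 : ℝ) < 1 / ((n : ℝ) + 2) := by positivity
          simp only [mem_compl_iff, mem_singleton_iff, neg_eq_zero, Complex.ofReal_eq_zero]
          exact hpos.ne'
      refine hseq.frequently (Frequently.of_forall fun n => ?_)
      rw [hGF]
      refine h3 ⟨?_, ?_⟩
      · have : (0 : ℝ) < 1 / ((n : ℝ) + 2) := by positivity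
        linarith
      · have h2n : (2 : ℝ) ≤ (n : ℝ) + 2 := by linarith [n.cast_nonneg (α := ℝ)]
        rw [div_lt_one (by positivity)]; linarith
    have := hA.eqOn_zero_of_preconnected_of_frequently_eq_zero isPreconnected_univ (mem_univ 0) hfreq
    exact fun z => this (mem_univ z)
  -- hence `𝓕 g = 0`, and by Plancherel `g = 0` a.e.
  have hF0 : F = 0 := funext fun t => by rw [← hGF t, hG0]; rfl
  have hP := integral_norm_sq_fourierIntegral_eq hgi (memLp_indicator_coeFn φ)
  rw [← hF, hF0] at hP
  simp only [Pi.zero_apply, norm_zero, ne_eq, OfNat.ofNat_ne_zero, not_false_eq_true, zero_pow,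
    integral_zero] at hP
  have hgi2 : Integrable (fun x => ‖g x‖ ^ 2) :=
    (memLp_two_iff_integrable_sq_norm (memLp_indicator_coeFn φ).1).1 (memLp_indicator_coeFn φ)
  have hg0 : ∀ᵐ x : ℝ, ‖g x‖ ^ 2 = 0 :=
    (integral_eq_zero_iff_of_nonneg_ae (Eventually.of_forall fun x => by positivity) hgi2).1 hP.symm
  -- transport to `L²([-1,1])`
  refine Lp.ext ?_
  have hg0' : ∀ᵐ x ∂(volume.restrict (Icc (-1 : ℝ) 1)), ‖g x‖ ^ 2 = 0 := ae_restrict_of_ae hg0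
  filter_upwards [hg0', ae_restrict_mem measurableSet_Icc,
    Lp.coeFn_zero ℂ 2 (volume.restrict (Icc (-1 : ℝ) 1))] with x hx hxI h0x
  rw [h0x, Pi.zero_apply]
  rw [hg, indicator_of_mem hxI] at hx
  simpa using hx

end Kernel

/-! ### Interface lemmas for the commutation step: kernel identity, finite-dimensional eigenspaces,
regularity of eigenfunctions (band-limited ⇒ smooth) -/

section Interface

variable {K : Lp ℂ 2 (volume.restrict (Icc (-1 : ℝ) 1)) →L[ℂ] Lp ℂ 2 (volume.restrict (Icc (-1 : ℝ) 1))}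

/-- The kernel as a product of characters: `κ(y − x) = ∫_{−1}^{1} e^{2πiξy} e^{−2πiξx} dξ`. [cite: ConnesConsani2021, §4 p. 16 eq. (prolateeq)–(cosalphan1) (arXiv p0016:L13–L34); SlepianPollak1961, §III] -/
theorem sincKernel_sub_eq_integral (y x : ℝ) :
    sincKernel (y - x) = ∫ ξ in (-1 : ℝ)..1, cexp (2 * π * I * ξ * y) * cexp (-(2 * π * I * ξ * x)) := by
  unfold sincKernel
  refine intervalIntegral.integral_congr (fun ξ _ => ?_)
  show cexp (2 * π * I * ξ * ((y - x : ℝ) : ℂ)) = cexp (2 * π * I * ξ * y) * cexp (-(2 * π * I * ξ * x))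
  rw [← Complex.exp_add]
  congr 1; push_cast; ring

/-- **The eigenspaces `E_ν = {S | KS = νS}`, `ν ≠ 0`, of the (compact) sinc operator are
finite-dimensional** (Mathlib's spectral theory of compact operators). [cite: ConnesConsani2021, §4 p. 16 eq. (prolateeq)–(cosalphan1) (arXiv p0016:L13–L34); SlepianPollak1961, §III] -/
theorem finiteDimensional_eigenspace_sincOp (hKc : IsCompactOperator K) {ν : ℝ} (hν : ν ≠ 0) :
    FiniteDimensional ℂ
      (Module.End.eigenspace (K : Lp ℂ 2 (volume.restrict (Icc (-1 : ℝ) 1)) →ₗ[ℂ]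
        Lp ℂ 2 (volume.restrict (Icc (-1 : ℝ) 1))) (ν : ℂ)) :=
  ContinuousLinearMap.finite_dimensional_eigenspace hKc (ν : ℂ) (by exact_mod_cast hν)

/-- Membership in `E_ν`: `S ∈ eigenspace K ν ↔ K S = ν • S`. [cite: ConnesConsani2021, §4 p. 16 eq. (prolateeq)–(cosalphan1) (arXiv p0016:L13–L34); SlepianPollak1961, §III] -/
theorem mem_eigenspace_sincOp_iff {ν : ℝ} {S : Lp ℂ 2 (volume.restrict (Icc (-1 : ℝ) 1))} :
    S ∈ Module.End.eigenspace (K : Lp ℂ 2 (volume.restrict (Icc (-1 : ℝ) 1)) →ₗ[ℂ]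
        Lp ℂ 2 (volume.restrict (Icc (-1 : ℝ) 1))) (ν : ℂ) ↔ K S = (ν : ℂ) • S := by
  rw [Module.End.mem_eigenspace_iff]; rfl

/-- The band-limited function `y ↦ ∫_{−1}^{1} e^{2πiξy} G(ξ) dξ` is smooth for `G` continuous on
`[−1,1]` (Fourier integral of a bounded compactly supported function: Mathlib `contDiff_fourier`). [folklore] -/
private theorem contDiff_integral_cexp_mul {G : ℝ → ℂ} (hG : Continuous G) :
    ContDiff ℝ (⊤ : ℕ∞) fun y : ℝ => ∫ ξ in Ioc (-1 : ℝ) 1, cexp (2 * π * I * ξ * y) * G ξ := by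
  set G₁ : ℝ → ℂ := (Ioc (-1 : ℝ) 1).indicator G with hG₁
  have hrepr : (fun y : ℝ => ∫ ξ in Ioc (-1 : ℝ) 1, cexp (2 * π * I * ξ * y) * G ξ) =
      fun y => 𝓕 G₁ (-y) := by
    funext y
    rw [Real.fourier_real_eq_integral_exp_smul, ← integral_indicator measurableSet_Ioc]
    refine integral_congr_ae (Eventually.of_forall fun ξ => ?_)
    simp only [smul_eq_mul, hG₁]
    by_cases hξ : ξ ∈ Ioc (-1 : ℝ) 1
    · rw [indicator_of_mem hξ, indicator_of_mem hξ]; congr 1; push_cast; ring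
    · rw [indicator_of_notMem hξ, indicator_of_notMem hξ, mul_zero]
  rw [hrepr]
  refine (Real.contDiff_fourier (N := (⊤ : ℕ∞)) fun n _ => ?_).comp contDiff_neg
  -- `‖v‖^n ‖G₁ v‖` is the indicator of a function continuous on `[-1, 1]`
  have hcont : Continuous fun v : ℝ => ‖v‖ ^ n * ‖G v‖ := by fun_prop
  have h1 : IntegrableOn (fun v : ℝ => ‖v‖ ^ n * ‖G v‖) (Ioc (-1 : ℝ) 1) :=
    (hcont.integrableOn_Icc (a := -1) (b := 1)).mono_set Ioc_subset_Icc_self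
  rw [← integrable_indicator_iff measurableSet_Ioc] at h1
  refine h1.congr (Eventually.of_forall fun v => ?_)
  simp only [hG₁]
  by_cases hv : v ∈ Ioc (-1 : ℝ) 1
  · rw [indicator_of_mem hv, indicator_of_mem hv]
  · rw [indicator_of_notMem hv, indicator_of_notMem hv, norm_zero, mul_zero]

/-- **Regularity of the eigenfunctions (band-limited ⇒ smooth)**: an eigenvector `S` of the sinc
operator with eigenvalue `ν ≠ 0` has a representative `g` which is `C^∞` on all of `ℝ` and satisfies
the eigen-equation POINTWISE on `[−1,1]`: `ν g(y) = ∫_{−1}^{1} κ(y−x) g(x) dx` — namely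
`g(y) = ν⁻¹∫_{−1}^{1} κ(y−x)S(x)dx = ν⁻¹∫_{−1}^{1} e^{2πiξy} 𝓕(1_I S)(ξ) dξ` ("the prolate functions
extend to entire functions", Slepian–Pollak §III). [cite: SlepianPollak1961, §III; ConnesConsani2021, §4 p. 16 (arXiv p0016:L17–L21)] -/
theorem exists_smooth_repr_of_sincOp_eq_smul
    (hK : ∀ φ : Lp ℂ 2 (volume.restrict (Icc (-1 : ℝ) 1)),
      (K φ : ℝ → ℂ) =ᵐ[volume.restrict (Icc (-1 : ℝ) 1)]
        fun y => ∫ x in Icc (-1 : ℝ) 1, sincKernel (y - x) * (φ : ℝ → ℂ) x)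
    {ν : ℝ} (hν : ν ≠ 0) {S : Lp ℂ 2 (volume.restrict (Icc (-1 : ℝ) 1))} (hS : K S = (ν : ℂ) • S) :
    ∃ g : ℝ → ℂ, ContDiff ℝ (⊤ : ℕ∞) g ∧
      (S : ℝ → ℂ) =ᵐ[volume.restrict (Icc (-1 : ℝ) 1)] g ∧
      ∀ y ∈ Icc (-1 : ℝ) 1, (ν : ℂ) * g y = ∫ x in Icc (-1 : ℝ) 1, sincKernel (y - x) * g x := by
  have hν' : (ν : ℂ) ≠ 0 := by exact_mod_cast hν
  set g : ℝ → ℂ := fun y => (ν : ℂ)⁻¹ * ∫ x in Icc (-1 : ℝ) 1, sincKernel (y - x) * (S : ℝ → ℂ) x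
    with hg
  -- `S = g` a.e. on `[-1, 1]`
  have hae : (S : ℝ → ℂ) =ᵐ[volume.restrict (Icc (-1 : ℝ) 1)] g := by
    have h1 := hK S
    rw [hS] at h1
    filter_upwards [h1, Lp.coeFn_smul (ν : ℂ) S] with y hy hy'
    rw [hg]
    simp only []
    rw [← hy, hy', Pi.smul_apply, smul_eq_mul, ← mul_assoc, inv_mul_cancel₀ hν', one_mul]
  refine ⟨g, ?_, hae, fun y _ => ?_⟩
  · -- smoothness: `g(y) = ν⁻¹ ∫_{Ioc} e^{2πiξy} 𝓕(1_I S)(ξ) dξ`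
    have hrepr : g = fun y : ℝ => (ν : ℂ)⁻¹ * ∫ ξ in Ioc (-1 : ℝ) 1, cexp (2 * π * I * ξ * y) *
        𝓕 ((Icc (-1 : ℝ) 1).indicator (S : ℝ → ℂ)) ξ := by
      funext y; rw [hg]; simp only []; rw [integral_sincKernel_mul_eq]
    rw [hrepr]
    exact contDiff_const.mul (contDiff_integral_cexp_mul (continuous_fourier_indicator S))
  · -- the eigen-equation for `g`: replace `S` by `g` inside the integral
    have h2 : ∫ x in Icc (-1 : ℝ) 1, sincKernel (y - x) * g x =
        ∫ x in Icc (-1 : ℝ) 1, sincKernel (y - x) * (S : ℝ → ℂ) x := by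
      refine integral_congr_ae ?_
      filter_upwards [hae] with x hx
      rw [hx]
    rw [h2, hg]
    simp only []
    rw [← mul_assoc, mul_inv_cancel₀ hν', one_mul]

/-- The `C²` form of the regularity statement (as consumed by the ODE argument). [cite: SlepianPollak1961, §III] -/
theorem exists_contDiff_two_repr_of_sincOp_eq_smul
    (hK : ∀ φ : Lp ℂ 2 (volume.restrict (Icc (-1 : ℝ) 1)),
      (K φ : ℝ → ℂ) =ᵐ[volume.restrict (Icc (-1 : ℝ) 1)]
        fun y => ∫ x in Icc (-1 : ℝ) 1, sincKernel (y - x) * (φ : ℝ → ℂ) x)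
    {ν : ℝ} (hν : ν ≠ 0) {S : Lp ℂ 2 (volume.restrict (Icc (-1 : ℝ) 1))} (hS : K S = (ν : ℂ) • S) :
    ∃ g : ℝ → ℂ, ContDiff ℝ 2 g ∧
      (S : ℝ → ℂ) =ᵐ[volume.restrict (Icc (-1 : ℝ) 1)] g ∧
      ∀ y ∈ Icc (-1 : ℝ) 1, (ν : ℂ) * g y = ∫ x in Icc (-1 : ℝ) 1, sincKernel (y - x) * g x := by
  obtain ⟨g, hg, hae, heq⟩ := exists_smooth_repr_of_sincOp_eq_smul hK hν hS
  refine ⟨g, hg.of_le ?_, hae, heq⟩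
  change ((2 : ℕ∞) : WithTop ℕ∞) ≤ ((⊤ : ℕ∞) : WithTop ℕ∞)
  exact WithTop.coe_le_coe.2 le_top

end Interface

/-! ### Reflection symmetry, even eigenfunctions, and the assembly of the completeness statement
modulo the commutation/identification step (module (b), `ProlateCommutation`, seat t3) -/

section Assembly

/-- `x ↦ −x` preserves Lebesgue measure restricted to `[−1,1]` (the parity symmetry of the prolate
problem). [cite: ConnesConsani2021, §4 p. 16 (arXiv p0016:L21–L27); SlepianPollak1961, §III] -/
theorem measurePreserving_neg_Icc :
    MeasurePreserving (fun x : ℝ => -x) (volume.restrict (Icc (-1 : ℝ) 1))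
      (volume.restrict (Icc (-1 : ℝ) 1)) := by
  have h := (Measure.measurePreserving_neg (volume : Measure ℝ)).restrict_preimage
    (measurableSet_Icc : MeasurableSet (Icc (-1 : ℝ) 1))
  have hs : (Neg.neg : ℝ → ℝ) ⁻¹' Icc (-1 : ℝ) 1 = Icc (-1) 1 := by
    ext x; simp only [mem_preimage, mem_Icc]; constructor <;> intro h <;> constructor <;> linarith
  rw [hs] at h
  exact h

variable {K : Lp ℂ 2 (volume.restrict (Icc (-1 : ℝ) 1)) →L[ℂ] Lp ℂ 2 (volume.restrict (Icc (-1 : ℝ) 1))}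

/-- **The sinc operator commutes with the reflection `(Rφ)(x) = φ(−x)`** (its kernel is even).
[cite: ConnesConsani2021, §4 p. 16 (parity of the prolate functions, arXiv p0016:L21–L27); SlepianPollak1961, §III] -/
theorem sincOp_comp_reflection
    (hK : ∀ φ : Lp ℂ 2 (volume.restrict (Icc (-1 : ℝ) 1)),
      (K φ : ℝ → ℂ) =ᵐ[volume.restrict (Icc (-1 : ℝ) 1)]
        fun y => ∫ x in Icc (-1 : ℝ) 1, sincKernel (y - x) * (φ : ℝ → ℂ) x)
    (φ : Lp ℂ 2 (volume.restrict (Icc (-1 : ℝ) 1))) :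
    K (Lp.compMeasurePreservingₗ ℂ (fun x : ℝ => -x) measurePreserving_neg_Icc φ) =
      Lp.compMeasurePreservingₗ ℂ (fun x : ℝ => -x) measurePreserving_neg_Icc (K φ) := by
  set R : Lp ℂ 2 (volume.restrict (Icc (-1 : ℝ) 1)) →ₗ[ℂ] Lp ℂ 2 (volume.restrict (Icc (-1 : ℝ) 1)) :=
    Lp.compMeasurePreservingₗ ℂ (fun x : ℝ => -x) measurePreserving_neg_Icc with hR
  have hRφ : (R φ : ℝ → ℂ) =ᵐ[volume.restrict (Icc (-1 : ℝ) 1)] fun x => (φ : ℝ → ℂ) (-x) :=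
    Lp.coeFn_compMeasurePreserving φ measurePreserving_neg_Icc
  have hRK : (R (K φ) : ℝ → ℂ) =ᵐ[volume.restrict (Icc (-1 : ℝ) 1)] fun y => (K φ : ℝ → ℂ) (-y) :=
    Lp.coeFn_compMeasurePreserving (K φ) measurePreserving_neg_Icc
  -- both sides are a.e. equal to `y ↦ ∫ κ(y + x) φ(x) dx`
  refine Lp.ext ?_
  have h1 : (K (R φ) : ℝ → ℂ) =ᵐ[volume.restrict (Icc (-1 : ℝ) 1)]
      fun y => ∫ x in Icc (-1 : ℝ) 1, sincKernel (y + x) * (φ : ℝ → ℂ) x := by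
    filter_upwards [hK (R φ)] with y hy
    rw [hy]
    have e1 : ∫ x in Icc (-1 : ℝ) 1, sincKernel (y - x) * (R φ : ℝ → ℂ) x =
        ∫ x in Icc (-1 : ℝ) 1, sincKernel (y - x) * (φ : ℝ → ℂ) (-x) := by
      refine integral_congr_ae ?_
      filter_upwards [hRφ] with x hx
      rw [hx]
    rw [e1]
    have e2 := measurePreserving_neg_Icc.integral_comp (Homeomorph.neg ℝ).measurableEmbedding
      (fun u : ℝ => sincKernel (y + u) * (φ : ℝ → ℂ) u)
    rw [← e2]
    refine integral_congr_ae (Eventually.of_forall fun x => ?_)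
    show sincKernel (y - x) * (φ : ℝ → ℂ) (-x) = sincKernel (y + -x) * (φ : ℝ → ℂ) (-x)
    rw [sub_eq_add_neg]
  have h2 : (R (K φ) : ℝ → ℂ) =ᵐ[volume.restrict (Icc (-1 : ℝ) 1)]
      fun y => ∫ x in Icc (-1 : ℝ) 1, sincKernel (y + x) * (φ : ℝ → ℂ) x := by
    have h3 : (fun y => (K φ : ℝ → ℂ) (-y)) =ᵐ[volume.restrict (Icc (-1 : ℝ) 1)]
        fun y => ∫ x in Icc (-1 : ℝ) 1, sincKernel (-y - x) * (φ : ℝ → ℂ) x :=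
      measurePreserving_neg_Icc.quasiMeasurePreserving.ae_eq_comp (hK φ)
    filter_upwards [hRK, h3] with y hy hy'
    rw [hy, hy']
    refine integral_congr_ae (Eventually.of_forall fun x => ?_)
    simp only []
    rw [show -y - x = -(y + x) by ring, sincKernel_neg]
  exact h1.trans h2.symm

/-- For an eigenvector `S ∈ E_ν` the reflected vector `RS` is again in `E_ν`. [cite: SlepianPollak1961, §III] -/
theorem reflection_mem_eigenspace
    (hK : ∀ φ : Lp ℂ 2 (volume.restrict (Icc (-1 : ℝ) 1)),
      (K φ : ℝ → ℂ) =ᵐ[volume.restrict (Icc (-1 : ℝ) 1)]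
        fun y => ∫ x in Icc (-1 : ℝ) 1, sincKernel (y - x) * (φ : ℝ → ℂ) x)
    {ν : ℝ} {S : Lp ℂ 2 (volume.restrict (Icc (-1 : ℝ) 1))} (hS : K S = (ν : ℂ) • S) :
    K (Lp.compMeasurePreservingₗ ℂ (fun x : ℝ => -x) measurePreserving_neg_Icc S) =
      (ν : ℂ) • Lp.compMeasurePreservingₗ ℂ (fun x : ℝ => -x) measurePreserving_neg_Icc S := by
  rw [sincOp_comp_reflection hK, hS, LinearMap.map_smul]

/-- **An a.e.-even `f ∈ L²([−1,1])` orthogonal to all even prolate functions is orthogonal to every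
eigenvector of the sinc operator with non-zero eigenvalue** (split `S = ½(S+RS) + ½(S−RS)`: the even
part lies in `E_ν`, hence in the span of the prolate functions by the commutation/identification step;
the odd part is orthogonal to the even `f`). [cite: SlepianPollak1961, §III; ConnesConsani2021, Prop. 4.5 (i) §4 p. 16] -/
theorem inner_eigenvector_eq_zero
    (hK : ∀ φ : Lp ℂ 2 (volume.restrict (Icc (-1 : ℝ) 1)),
      (K φ : ℝ → ℂ) =ᵐ[volume.restrict (Icc (-1 : ℝ) 1)]
        fun y => ∫ x in Icc (-1 : ℝ) 1, sincKernel (y - x) * (φ : ℝ → ℂ) x)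
    (hstep3 : ∀ {ν : ℝ}, ν ≠ 0 → ∀ {S : Lp ℂ 2 (volume.restrict (Icc (-1 : ℝ) 1))},
      K S = (ν : ℂ) • S → (∀ᵐ x ∂(volume.restrict (Icc (-1 : ℝ) 1)), (S : ℝ → ℂ) (-x) = (S : ℝ → ℂ) x) →
        S ∈ Submodule.span ℂ (Set.range prolateXiI))
    {f : Lp ℂ 2 (volume.restrict (Icc (-1 : ℝ) 1))}
    (heven : ∀ᵐ x ∂(volume.restrict (Icc (-1 : ℝ) 1)), (f : ℝ → ℂ) (-x) = (f : ℝ → ℂ) x)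
    (horth : ∀ n : ℕ, ⟪prolateXiI n, f⟫_ℂ = 0)
    {ν : ℝ} (hν : ν ≠ 0) {S : Lp ℂ 2 (volume.restrict (Icc (-1 : ℝ) 1))} (hS : K S = (ν : ℂ) • S) :
    ⟪S, f⟫_ℂ = 0 := by
  set R : Lp ℂ 2 (volume.restrict (Icc (-1 : ℝ) 1)) →ₗ[ℂ] Lp ℂ 2 (volume.restrict (Icc (-1 : ℝ) 1)) :=
    Lp.compMeasurePreservingₗ ℂ (fun x : ℝ => -x) measurePreserving_neg_Icc with hR
  have hRS : (R S : ℝ → ℂ) =ᵐ[volume.restrict (Icc (-1 : ℝ) 1)] fun x => (S : ℝ → ℂ) (-x) :=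
    Lp.coeFn_compMeasurePreserving S measurePreserving_neg_Icc
  have hRS' : (fun x => (R S : ℝ → ℂ) (-x)) =ᵐ[volume.restrict (Icc (-1 : ℝ) 1)]
      fun x => (S : ℝ → ℂ) (-(-x)) :=
    measurePreserving_neg_Icc.quasiMeasurePreserving.ae_eq_comp hRS
  -- the even part `S + RS ∈ E_ν` is in the span of the prolate functions, hence orthogonal to `f`
  have hE : K (S + R S) = (ν : ℂ) • (S + R S) := by
    rw [map_add, hS, smul_add]
    congr 1
    exact reflection_mem_eigenspace hK hS
  have hEven : ∀ᵐ x ∂(volume.restrict (Icc (-1 : ℝ) 1)),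
      ((S + R S : Lp ℂ 2 (volume.restrict (Icc (-1 : ℝ) 1))) : ℝ → ℂ) (-x) =
        ((S + R S : Lp ℂ 2 (volume.restrict (Icc (-1 : ℝ) 1))) : ℝ → ℂ) x := by
    have ha := Lp.coeFn_add S (R S)
    filter_upwards [ha, measurePreserving_neg_Icc.quasiMeasurePreserving.ae_eq_comp ha, hRS, hRS']
      with x hx hx' h1 h2
    simp only [Function.comp_apply] at hx'
    rw [hx', hx, Pi.add_apply, Pi.add_apply, h1, h2, neg_neg, add_comm]
  have hspan : S + R S ∈ Submodule.span ℂ (Set.range prolateXiI) := hstep3 hν hE hEven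
  have h1 : ⟪S + R S, f⟫_ℂ = 0 := by
    -- `f` is orthogonal to the span of the `prolateXiI n`
    have hf : f ∈ (Submodule.span ℂ (Set.range prolateXiI))ᗮ := by
      rw [Submodule.mem_orthogonal]
      intro u hu
      refine Submodule.span_induction (p := fun u _ => ⟪u, f⟫_ℂ = 0) ?_ ?_ ?_ ?_ hu
      · rintro _ ⟨n, rfl⟩; exact horth n
      · exact inner_zero_left _
      · intro u v _ _ hu hv; rw [inner_add_left, hu, hv, add_zero]
      · intro c u _ hu; rw [inner_smul_left, hu, mul_zero]
    exact (Submodule.mem_orthogonal _ _).1 hf _ hspan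
  -- the odd part `S - RS` is orthogonal to the even `f`
  have h2 : ⟪S - R S, f⟫_ℂ = 0 := by
    have hsub := Lp.coeFn_sub S (R S)
    -- `⟪S - RS, f⟫ = ∫ conj(S(x) - S(-x)) f(x) dx`; substituting `x ↦ -x` flips the sign
    have e1 : ⟪S - R S, f⟫_ℂ = ∫ x in Icc (-1 : ℝ) 1,
        conj ((S : ℝ → ℂ) x - (S : ℝ → ℂ) (-x)) * (f : ℝ → ℂ) x := by
      rw [L2.inner_def]
      refine integral_congr_ae ?_
      filter_upwards [hsub, hRS] with x hx h1
      rw [RCLike.inner_apply', hx, Pi.sub_apply, h1]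
    have e2 : ∫ x in Icc (-1 : ℝ) 1, conj ((S : ℝ → ℂ) x - (S : ℝ → ℂ) (-x)) * (f : ℝ → ℂ) x =
        ∫ x in Icc (-1 : ℝ) 1, conj ((S : ℝ → ℂ) (-x) - (S : ℝ → ℂ) x) * (f : ℝ → ℂ) x := by
      have e3 := measurePreserving_neg_Icc.integral_comp (Homeomorph.neg ℝ).measurableEmbedding
        (fun u : ℝ => conj ((S : ℝ → ℂ) u - (S : ℝ → ℂ) (-u)) * (f : ℝ → ℂ) u)
      simp only [neg_neg] at e3
      rw [← e3]
      refine integral_congr_ae ?_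
      filter_upwards [heven] with x hx
      rw [hx]
    have e4 : ∫ x in Icc (-1 : ℝ) 1, conj ((S : ℝ → ℂ) (-x) - (S : ℝ → ℂ) x) * (f : ℝ → ℂ) x =
        -∫ x in Icc (-1 : ℝ) 1, conj ((S : ℝ → ℂ) x - (S : ℝ → ℂ) (-x)) * (f : ℝ → ℂ) x := by
      rw [← integral_neg]
      refine integral_congr_ae (Eventually.of_forall fun x => ?_)
      simp only [map_sub]
      ring
    rw [e1]
    have := e2.trans e4
    linear_combination this / 2
  have h3 : (2 : ℂ) • S = (S + R S) + (S - R S) := by rw [two_smul]; abel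
  have h4 : ⟪(2 : ℂ) • S, f⟫_ℂ = 0 := by rw [h3, inner_add_left, h1, h2, add_zero]
  rw [inner_smul_left] at h4
  simpa using h4

/-- **Assembly on `L²([−1,1])`**: an a.e.-even `f ∈ L²([−1,1])` orthogonal to all even prolate functions
vanishes (Hilbert eigenbasis of the compact self-adjoint `K`; `f ⊥ E_ν` for `ν ≠ 0` by
`inner_eigenvector_eq_zero`; hence `Kf = 0`; hence `f = 0` by `ker K = 0`).
[cite: SlepianPollak1961, §III ("the ψ_n are complete in L²(−T/2,T/2)"); ConnesConsani2021, Prop. 4.5 (i) §4 p. 16] -/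
theorem eq_zero_of_even_of_orthogonal_prolateXiI
    (hstep3 : ∀ (K : Lp ℂ 2 (volume.restrict (Icc (-1 : ℝ) 1)) →L[ℂ]
        Lp ℂ 2 (volume.restrict (Icc (-1 : ℝ) 1))),
      (∀ φ : Lp ℂ 2 (volume.restrict (Icc (-1 : ℝ) 1)),
        (K φ : ℝ → ℂ) =ᵐ[volume.restrict (Icc (-1 : ℝ) 1)]
          fun y => ∫ x in Icc (-1 : ℝ) 1, sincKernel (y - x) * (φ : ℝ → ℂ) x) →
      IsCompactOperator K → IsSelfAdjoint K →
      ∀ {ν : ℝ}, ν ≠ 0 → ∀ {S : Lp ℂ 2 (volume.restrict (Icc (-1 : ℝ) 1))},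
        K S = (ν : ℂ) • S →
        (∀ᵐ x ∂(volume.restrict (Icc (-1 : ℝ) 1)), (S : ℝ → ℂ) (-x) = (S : ℝ → ℂ) x) →
          S ∈ Submodule.span ℂ (Set.range prolateXiI))
    {f : Lp ℂ 2 (volume.restrict (Icc (-1 : ℝ) 1))}
    (heven : ∀ᵐ x ∂(volume.restrict (Icc (-1 : ℝ) 1)), (f : ℝ → ℂ) (-x) = (f : ℝ → ℂ) x)
    (horth : ∀ n : ℕ, ⟪prolateXiI n, f⟫_ℂ = 0) : f = 0 := by
  obtain ⟨K, hK, hKsa, hKc, -⟩ := exists_sincOp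
  obtain ⟨s, b, κ, -, hb⟩ := exists_hilbertBasis_eigenvectors_of_isSelfAdjoint hKc hKsa
  -- `⟪b i, f⟫ κ_i = 0` for every `i`
  have hcoef : ∀ i, (b.repr f i) • K (b i) = 0 := by
    intro i
    rw [hb i, HilbertBasis.repr_apply_apply]
    by_cases hi : κ i = 0
    · rw [hi]; simp
    · rw [inner_eigenvector_eq_zero hK (fun {ν'} hν' {S'} hS' hev' => hstep3 K hK hKc hKsa hν' hS' hev')
          heven horth hi (hb i), zero_smul]
  -- `K f = Σ ⟪b i, f⟫ K (b i) = 0`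
  have hsum : HasSum (fun i => (b.repr f i) • K (b i)) (K f) := by
    have h := (b.hasSum_repr f).mapL K
    simp only [ContinuousLinearMap.map_smul] at h
    exact h
  have hKf : K f = 0 := by
    have h0 : HasSum (fun i => (b.repr f i) • K (b i)) 0 := by
      simp only [hcoef]; exact hasSum_zero
    exact hsum.unique h0
  exact eq_zero_of_sincOp_eq_zero hK hKf

/-- **Even eigenvectors have EVEN smooth representatives**: if moreover `S(−x) = S(x)` a.e. on `[−1,1]`,
the smooth representative `g = ν⁻¹∫κ(·−x)S(x)dx` of `exists_smooth_repr_of_sincOp_eq_smul` is an even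
function on all of `ℝ` (`κ` even, substitution `x ↦ −x`). [cite: SlepianPollak1961, §III; ConnesConsani2021, §4 p. 16 (arXiv p0016:L21–L27)] -/
theorem exists_smooth_even_repr_of_sincOp_eq_smul
    (hK : ∀ φ : Lp ℂ 2 (volume.restrict (Icc (-1 : ℝ) 1)),
      (K φ : ℝ → ℂ) =ᵐ[volume.restrict (Icc (-1 : ℝ) 1)]
        fun y => ∫ x in Icc (-1 : ℝ) 1, sincKernel (y - x) * (φ : ℝ → ℂ) x)
    {ν : ℝ} (hν : ν ≠ 0) {S : Lp ℂ 2 (volume.restrict (Icc (-1 : ℝ) 1))} (hS : K S = (ν : ℂ) • S)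
    (heven : ∀ᵐ x ∂(volume.restrict (Icc (-1 : ℝ) 1)), (S : ℝ → ℂ) (-x) = (S : ℝ → ℂ) x) :
    ∃ g : ℝ → ℂ, ContDiff ℝ (⊤ : ℕ∞) g ∧ (∀ y, g (-y) = g y) ∧
      (S : ℝ → ℂ) =ᵐ[volume.restrict (Icc (-1 : ℝ) 1)] g ∧
      ∀ y ∈ Icc (-1 : ℝ) 1, (ν : ℂ) * g y = ∫ x in Icc (-1 : ℝ) 1, sincKernel (y - x) * g x := by
  obtain ⟨g, hg, hae, heq⟩ := exists_smooth_repr_of_sincOp_eq_smul hK hν hS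
  -- the smooth function `G y := ν⁻¹ ∫ κ(y - x) g(x) dx` agrees with `g` on `[-1,1]`; but we want a
  -- globally even representative: take `G` itself, defined by the integral formula for all `y`.
  set G : ℝ → ℂ := fun y => (ν : ℂ)⁻¹ * ∫ x in Icc (-1 : ℝ) 1, sincKernel (y - x) * (S : ℝ → ℂ) x
    with hGdef
  have hν' : (ν : ℂ) ≠ 0 := by exact_mod_cast hν
  -- `G = g` a.e. on `[-1,1]` (indeed everywhere on `[-1,1]`), so `G` is also a representative
  have hGg : ∀ y ∈ Icc (-1 : ℝ) 1, G y = g y := by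
    intro y hy
    have e1 : ∫ x in Icc (-1 : ℝ) 1, sincKernel (y - x) * (S : ℝ → ℂ) x =
        ∫ x in Icc (-1 : ℝ) 1, sincKernel (y - x) * g x := by
      refine integral_congr_ae ?_
      filter_upwards [hae] with x hx
      rw [hx]
    rw [hGdef]
    simp only []
    rw [e1, ← heq y hy, ← mul_assoc, inv_mul_cancel₀ hν', one_mul]
  -- smoothness of `G` (band-limited, as in `exists_smooth_repr_of_sincOp_eq_smul`)
  have hGsmooth : ContDiff ℝ (⊤ : ℕ∞) G := by
    have hrepr : G = fun y : ℝ => (ν : ℂ)⁻¹ * ∫ ξ in Ioc (-1 : ℝ) 1, cexp (2 * π * I * ξ * y) *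
        𝓕 ((Icc (-1 : ℝ) 1).indicator (S : ℝ → ℂ)) ξ := by
      funext y; rw [hGdef]; simp only []; rw [integral_sincKernel_mul_eq]
    rw [hrepr]
    exact contDiff_const.mul (contDiff_integral_cexp_mul (continuous_fourier_indicator S))
  -- evenness of `G`: `κ` even and `S` even a.e.
  have hGeven : ∀ y, G (-y) = G y := by
    intro y
    rw [hGdef]
    simp only []
    congr 1
    have e2 := measurePreserving_neg_Icc.integral_comp (Homeomorph.neg ℝ).measurableEmbedding
      (fun u : ℝ => sincKernel (-y - u) * (S : ℝ → ℂ) u)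
    rw [← e2]
    refine integral_congr_ae ?_
    filter_upwards [heven] with x hx
    show sincKernel (-y - -x) * (S : ℝ → ℂ) (-x) = sincKernel (y - x) * (S : ℝ → ℂ) x
    rw [hx, show -y - -x = -(y - x) by ring, sincKernel_neg]
  refine ⟨G, hGsmooth, hGeven, ?_, fun y hy => ?_⟩
  · filter_upwards [hae, ae_restrict_mem measurableSet_Icc] with x hx hxI
    rw [hx, hGg x hxI]
  · have e3 : ∫ x in Icc (-1 : ℝ) 1, sincKernel (y - x) * G x =
        ∫ x in Icc (-1 : ℝ) 1, sincKernel (y - x) * g x :=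
      setIntegral_congr_fun measurableSet_Icc fun x hx => by rw [hGg x hx]
    rw [e3, hGg y hy]
    exact heq y hy

end Assembly

/-! ### Transport `L²(ℝ) ⊇ range 𝒫₁ ≅ L²([−1,1])` and the discharge -/

section Transport

/-- `⟪prolateXiI n, f⟫_{L²([−1,1])} = ⟪prolateXi n, ξ⟫_{L²(ℝ)}` when `f` is the restriction of `ξ`.
[cite: ConnesConsani2021, Prop. 4.5 (i) §4 p. 16 (arXiv p0016:L50)] -/
theorem inner_prolateXiI_restrict (ξ : Lp ℂ 2 (volume : Measure ℝ)) (n : ℕ) :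
    ⟪prolateXiI n, ((Lp.memLp ξ).restrict (Icc (-1 : ℝ) 1)).toLp (ξ : ℝ → ℂ)⟫_ℂ =
      ⟪prolateXi n, ξ⟫_ℂ := by
  rw [L2.inner_def, L2.inner_def]
  have h1 : ∫ x, ⟪(prolateXiI n : ℝ → ℂ) x,
      ((((Lp.memLp ξ).restrict (Icc (-1 : ℝ) 1)).toLp (ξ : ℝ → ℂ) : Lp ℂ 2 _) : ℝ → ℂ) x⟫_ℂ
        ∂(volume.restrict (Icc (-1 : ℝ) 1)) =
      ∫ x in Icc (-1 : ℝ) 1, conj (prolateXiFun n x) * (ξ : ℝ → ℂ) x := by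
    refine integral_congr_ae ?_
    have ha : (prolateXiI n : ℝ → ℂ) =ᵐ[volume.restrict (Icc (-1 : ℝ) 1)] prolateXiFun n :=
      MemLp.coeFn_toLp _
    have hb : ((((Lp.memLp ξ).restrict (Icc (-1 : ℝ) 1)).toLp (ξ : ℝ → ℂ) : Lp ℂ 2 _) : ℝ → ℂ)
        =ᵐ[volume.restrict (Icc (-1 : ℝ) 1)] (ξ : ℝ → ℂ) := MemLp.coeFn_toLp _
    filter_upwards [ha, hb] with x hx hx'
    rw [hx, hx', RCLike.inner_apply']
  have h2 : ∫ x, ⟪(prolateXi n : ℝ → ℂ) x, (ξ : ℝ → ℂ) x⟫_ℂ =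
      ∫ x, (Icc (-1 : ℝ) 1).indicator (fun x => conj (prolateXiFun n x) * (ξ : ℝ → ℂ) x) x := by
    refine integral_congr_ae ?_
    filter_upwards [prolateXi_coeFn n] with x hx
    rw [hx, RCLike.inner_apply']
    by_cases hxI : x ∈ Icc (-1 : ℝ) 1
    · rw [indicator_of_mem hxI]
    · rw [indicator_of_notMem hxI, prolateXiFun_eq_indicator, indicator_of_notMem hxI, map_zero,
        zero_mul]
  rw [h1, h2, integral_indicator measurableSet_Icc]

/-- **Discharge modulo the commutation step** (`hstep3` = the statement module (b) delivers: every even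
eigenvector with non-zero eigenvalue lies in the span of the `prolateXiI n`) `⇒ CC2021_sec4_xi_complete`
— an even `ξ ∈ L²(ℝ)` supported in `[−1,1]` and orthogonal to all `ξ_n` vanishes (restrict to `[−1,1]`,
`eq_zero_of_even_of_orthogonal_prolateXiI`, and `ξ = 1_{[−1,1]}ξ`).
[cite: ConnesConsani2021, Prop. 4.5 (i)–(ii) §4 p. 16 (arXiv p0016:L48–L66); SlepianPollak1961, §III] -/
theorem CC2021_sec4_xi_complete_of_commutation
    (hstep3 : ∀ (K : Lp ℂ 2 (volume.restrict (Icc (-1 : ℝ) 1)) →L[ℂ]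
        Lp ℂ 2 (volume.restrict (Icc (-1 : ℝ) 1))),
      (∀ φ : Lp ℂ 2 (volume.restrict (Icc (-1 : ℝ) 1)),
        (K φ : ℝ → ℂ) =ᵐ[volume.restrict (Icc (-1 : ℝ) 1)]
          fun y => ∫ x in Icc (-1 : ℝ) 1, sincKernel (y - x) * (φ : ℝ → ℂ) x) →
      IsCompactOperator K → IsSelfAdjoint K →
      ∀ {ν : ℝ}, ν ≠ 0 → ∀ {S : Lp ℂ 2 (volume.restrict (Icc (-1 : ℝ) 1))},
        K S = (ν : ℂ) • S →
        (∀ᵐ x ∂(volume.restrict (Icc (-1 : ℝ) 1)), (S : ℝ → ℂ) (-x) = (S : ℝ → ℂ) x) →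
          S ∈ Submodule.span ℂ (Set.range prolateXiI)) :
    CC2021_sec4_xi_complete := by
  intro ξ hev hP horth
  set f : Lp ℂ 2 (volume.restrict (Icc (-1 : ℝ) 1)) :=
    ((Lp.memLp ξ).restrict (Icc (-1 : ℝ) 1)).toLp (ξ : ℝ → ℂ) with hfdef
  have hf : (f : ℝ → ℂ) =ᵐ[volume.restrict (Icc (-1 : ℝ) 1)] (ξ : ℝ → ℂ) := MemLp.coeFn_toLp _
  -- `f` is even a.e. on `[-1, 1]`
  have heven : ∀ᵐ x ∂(volume.restrict (Icc (-1 : ℝ) 1)), (f : ℝ → ℂ) (-x) = (f : ℝ → ℂ) x := by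
    have h1 : (fun x => (f : ℝ → ℂ) (-x)) =ᵐ[volume.restrict (Icc (-1 : ℝ) 1)]
        fun x => (ξ : ℝ → ℂ) (-x) :=
      measurePreserving_neg_Icc.quasiMeasurePreserving.ae_eq_comp hf
    filter_upwards [hf, h1, ae_restrict_of_ae (s := Icc (-1 : ℝ) 1) (mem_evenPart_iff.1 hev)]
      with x hx hx' hx''
    rw [hx', hx'', hx]
  -- `f` is orthogonal to the prolate functions
  have horth' : ∀ n : ℕ, ⟪prolateXiI n, f⟫_ℂ = 0 := fun n => by
    rw [hfdef, inner_prolateXiI_restrict, horth n]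
  have hf0 : f = 0 := eq_zero_of_even_of_orthogonal_prolateXiI hstep3 heven horth'
  -- hence `ξ = 0` a.e. on `[-1,1]`, and `ξ = 1_{[-1,1]} ξ` a.e.
  have h1 : ∀ᵐ x ∂(volume.restrict (Icc (-1 : ℝ) 1)), (ξ : ℝ → ℂ) x = 0 := by
    have h0 := Lp.coeFn_zero ℂ 2 (volume.restrict (Icc (-1 : ℝ) 1))
    rw [← hf0] at h0
    filter_upwards [hf, h0] with x hx hx'
    rw [← hx, hx', Pi.zero_apply]
  have h2 : ∀ᵐ x : ℝ, x ∈ Icc (-1 : ℝ) 1 → (ξ : ℝ → ℂ) x = 0 := (ae_restrict_iff' measurableSet_Icc).1 h1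
  have h3 : (ξ : ℝ → ℂ) =ᵐ[volume] (Icc (-1 : ℝ) 1).indicator (ξ : ℝ → ℂ) := by
    have h := cutoffProj_coeFn 1 ξ
    rw [hP] at h
    exact h
  refine Lp.ext ?_
  filter_upwards [h2, h3, Lp.coeFn_zero ℂ 2 (volume : Measure ℝ)] with x hx hx' h0
  rw [h0, Pi.zero_apply]
  by_cases hxI : x ∈ Icc (-1 : ℝ) 1
  · exact hx hxI
  · rw [hx', indicator_of_notMem hxI]

end Transport

/-! ### Function-level factorisation `K = F^* F` and the cosine form of the kernel (interface for (b)) -/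

section Factorisation

/-- **`K = F^*F` pointwise**: for `φ` integrable on `[−1,1]` and every `y`,
`∫_{−1}^{1} κ(y−x)φ(x) dx = ∫_{−1}^{1} e^{2πiξy} (∫_{−1}^{1} e^{−2πiξx} φ(x) dx) dξ` (Fubini on `[−1,1]²`).
[cite: ConnesConsani2021, Prop. 4.5 (iii) §4 p. 16 (arXiv p0016:L56–L59); SlepianPollak1961, §III] -/
theorem integral_sincKernel_mul (φ : ℝ → ℂ) (hφ : IntegrableOn φ (Icc (-1 : ℝ) 1)) (y : ℝ) :
    ∫ x in Icc (-1 : ℝ) 1, sincKernel (y - x) * φ x =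
      ∫ ξ in (-1 : ℝ)..1, cexp (2 * π * I * ξ * y) *
        ∫ x in Icc (-1 : ℝ) 1, cexp (-(2 * π * I * ξ * x)) * φ x := by
  rw [intervalIntegral.integral_of_le (by norm_num : (-1 : ℝ) ≤ 1)]
  have h1 : ∀ x : ℝ, sincKernel (y - x) * φ x =
      ∫ ξ in Ioc (-1 : ℝ) 1, cexp (2 * π * I * ξ * (y - x)) * φ x := by
    intro x
    rw [sincKernel, intervalIntegral.integral_of_le (by norm_num : (-1 : ℝ) ≤ 1), ← integral_mul_const]
    push_cast
    rfl
  simp_rw [h1]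
  have hint : Integrable (Function.uncurry fun (x ξ : ℝ) => cexp (2 * π * I * ξ * (y - x)) * φ x)
      ((volume.restrict (Icc (-1 : ℝ) 1)).prod (volume.restrict (Ioc (-1 : ℝ) 1))) := by
    change Integrable (fun z : ℝ × ℝ => cexp (2 * π * I * z.2 * (y - z.1)) * φ z.1) _
    have h2 : Integrable (fun z : ℝ × ℝ => φ z.1 * (1 : ℂ))
        ((volume.restrict (Icc (-1 : ℝ) 1)).prod (volume.restrict (Ioc (-1 : ℝ) 1))) :=
      hφ.mul_prod (integrable_const (1 : ℂ))
    refine (h2.bdd_mul (c := 1) (f := fun z : ℝ × ℝ => cexp (2 * π * I * z.2 * (y - z.1)))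
      (Continuous.aestronglyMeasurable (by fun_prop)) ?_).congr ?_
    · exact Eventually.of_forall fun z => by
        rw [show (2 * π * I * z.2 * (y - z.1) : ℂ) = ((2 * π * z.2 * (y - z.1) : ℝ) : ℂ) * I by
          push_cast; ring, Complex.norm_exp_ofReal_mul_I]
    · exact Eventually.of_forall fun z => by simp only [mul_one]
  rw [integral_integral_swap hint]
  refine integral_congr_ae (Eventually.of_forall fun ξ => ?_)
  simp only []
  rw [← integral_const_mul]
  refine integral_congr_ae (Eventually.of_forall fun x => ?_)
  simp only []
  rw [show (2 * π * I * ξ * (y - x) : ℂ) = 2 * π * I * ξ * y + -(2 * π * I * ξ * x) by ring,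
    Complex.exp_add]
  ring

/-- **The cosine form of the sinc kernel**: `κ(v) = ∫_{−1}^{1} cos(2πξv) dξ` (the sine part is odd in `ξ`).
[cite: ConnesConsani2021, §4 p. 16 eq. (cosalphan1) (arXiv p0016:L29–L34); SlepianPollak1961, §III] -/
theorem sincKernel_eq_integral_cos (v : ℝ) :
    sincKernel v = ∫ ξ in (-1 : ℝ)..1, ((Real.cos (2 * π * ξ * v) : ℝ) : ℂ) := by
  have h1 : sincKernel v = (sincKernel v + sincKernel (-v)) / 2 := by rw [sincKernel_neg]; ring
  rw [h1]
  unfold sincKernel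
  have hi : ∀ w : ℝ, IntervalIntegrable (fun ξ : ℝ => cexp (2 * π * I * ξ * w)) volume (-1) 1 :=
    fun w => (Continuous.intervalIntegrable (by fun_prop) _ _)
  rw [← intervalIntegral.integral_add (hi v) (hi (-v)), ← intervalIntegral.integral_div]
  refine intervalIntegral.integral_congr (fun ξ _ => ?_)
  show (cexp (2 * π * I * ξ * (v : ℝ)) + cexp (2 * π * I * ξ * ((-v : ℝ) : ℂ))) / 2 =
    ((Real.cos (2 * π * ξ * v) : ℝ) : ℂ)
  rw [Complex.ofReal_cos, Complex.cos]
  congr 1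
  congr 1
  · congr 1; push_cast; ring
  · congr 1; push_cast; ring

end Factorisation

/-! ### Eigenfunctions are restrictions of ENTIRE functions: finitely many zeros, real and imaginary parts
(interface for the identification step of module (b)) -/

section Entire

variable {K : Lp ℂ 2 (volume.restrict (Icc (-1 : ℝ) 1)) →L[ℂ] Lp ℂ 2 (volume.restrict (Icc (-1 : ℝ) 1))}

/-- An entire function either vanishes identically or has finitely many zeros on a compact real interval
(identity theorem). [folklore] -/
private theorem eq_zero_or_finite_real_zeros {G : ℂ → ℂ} (hG : Differentiable ℂ G) (a b : ℝ) :
    (∀ z, G z = 0) ∨ {x : ℝ | x ∈ Icc a b ∧ G x = 0}.Finite := by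
  by_cases hfin : {x : ℝ | x ∈ Icc a b ∧ G x = 0}.Finite
  · exact Or.inr hfin
  left
  have hZ' : ((fun x : ℝ => (x : ℂ)) '' {x : ℝ | x ∈ Icc a b ∧ G x = 0}).Infinite :=
    (infinite_image_iff Complex.ofReal_injective.injOn).2 hfin
  have hKc : IsCompact ((fun x : ℝ => (x : ℂ)) '' Icc a b) := isCompact_Icc.image Complex.continuous_ofReal
  obtain ⟨z₀, -, hz₀⟩ := hZ'.exists_accPt_of_subset_isCompact hKc (image_mono fun x hx => hx.1)
  have hfreq : ∃ᶠ z in 𝓝[≠] z₀, G z = 0 := by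
    refine (accPt_iff_frequently_nhdsNE.1 hz₀).mono ?_
    rintro _ ⟨x, hx, rfl⟩
    exact hx.2
  have hA : AnalyticOnNhd ℂ G univ := analyticOnNhd_univ_iff_differentiable.2 hG
  have h := hA.eqOn_zero_of_preconnected_of_frequently_eq_zero isPreconnected_univ (mem_univ z₀) hfreq
  exact fun z => h (mem_univ z)

/-- The restriction of an entire function to `ℝ` is smooth. [folklore] -/
private theorem contDiff_restrict_of_differentiable {G : ℂ → ℂ} (hG : Differentiable ℂ G) :
    ContDiff ℝ (⊤ : ℕ∞) fun x : ℝ => G x := by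
  have h1 : ContDiff ℂ (⊤ : ℕ∞) G := (analyticOn_univ_iff_differentiable.2 hG).contDiff
  exact (h1.restrict_scalars ℝ).comp Complex.ofRealCLM.contDiff

/-- **Even eigenvectors are restrictions of even ENTIRE functions, with finitely many zeros on `[−1,1]`**
("the ψ_n(c, t) can be extended to be entire functions of the complex variable t", Slepian–Pollak §III):
for `KS = νS`, `ν ≠ 0`, `S` a.e. even, there is an entire `G` with `G|_ℝ` even and smooth, `S = G|_ℝ` a.e.
on `[−1,1]`, the eigen-equation `νG(y) = ∫_{−1}^{1}κ(y−x)G(x)dx` pointwise on `[−1,1]`, and — unless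
`S = 0` — only finitely many zeros of `G` in `[−1,1]` (identity theorem).  `G(z) = ν⁻¹∫_{−1}^{1}e^{2πizξ}𝓕(1_IS)(ξ)dξ`
(tree `differentiable_fourierLaplaceInv`). [cite: SlepianPollak1961, §III (p. 45, "extended to be entire functions"); ConnesConsani2021, §4 p. 16] -/
theorem exists_entire_even_repr_of_sincOp_eq_smul
    (hK : ∀ φ : Lp ℂ 2 (volume.restrict (Icc (-1 : ℝ) 1)),
      (K φ : ℝ → ℂ) =ᵐ[volume.restrict (Icc (-1 : ℝ) 1)]
        fun y => ∫ x in Icc (-1 : ℝ) 1, sincKernel (y - x) * (φ : ℝ → ℂ) x)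
    {ν : ℝ} (hν : ν ≠ 0) {S : Lp ℂ 2 (volume.restrict (Icc (-1 : ℝ) 1))} (hS : K S = (ν : ℂ) • S)
    (heven : ∀ᵐ x ∂(volume.restrict (Icc (-1 : ℝ) 1)), (S : ℝ → ℂ) (-x) = (S : ℝ → ℂ) x) :
    ∃ G : ℂ → ℂ, Differentiable ℂ G ∧ ContDiff ℝ (⊤ : ℕ∞) (fun x : ℝ => G x) ∧
      (∀ y : ℝ, G (-y) = G y) ∧
      (S : ℝ → ℂ) =ᵐ[volume.restrict (Icc (-1 : ℝ) 1)] (fun x : ℝ => G x) ∧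
      (∀ y ∈ Icc (-1 : ℝ) 1, (ν : ℂ) * G y = ∫ x in Icc (-1 : ℝ) 1, sincKernel (y - x) * G x) ∧
      (S ≠ 0 → {x : ℝ | x ∈ Icc (-1 : ℝ) 1 ∧ G x = 0}.Finite) := by
  have hν' : (ν : ℂ) ≠ 0 := by exact_mod_cast hν
  obtain ⟨g, -, hgeven, hae, heq⟩ := exists_smooth_even_repr_of_sincOp_eq_smul hK hν hS heven
  -- the canonical representative `g₀ y = ν⁻¹ ∫ κ(y-x) S(x) dx` and its entire extension
  set F : ℝ → ℂ := 𝓕 ((Icc (-1 : ℝ) 1).indicator (S : ℝ → ℂ)) with hF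
  set F₁ : ℝ → ℂ := (Ioc (-1 : ℝ) 1).indicator F with hF₁
  have hFc : Continuous F := continuous_fourier_indicator S
  have hF₁i : Integrable F₁ := by
    rw [hF₁, integrable_indicator_iff measurableSet_Ioc]
    exact (hFc.integrableOn_Icc (a := -1) (b := 1)).mono_set Ioc_subset_Icc_self
  set G : ℂ → ℂ := fun z => (ν : ℂ)⁻¹ * ∫ ξ : ℝ, cexp (2 * π * I * z * ξ) * F₁ ξ with hGdef
  have hGd : Differentiable ℂ G := by
    refine (differentiable_const _).mul (differentiable_fourierLaplaceInv hF₁i zero_le_one fun ξ hξ => ?_)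
    rw [hF₁, indicator_of_notMem]
    rw [mem_Ioc, not_and_or, not_lt, not_le]
    rcases le_or_gt 0 ξ with h | h
    · right; rwa [abs_of_nonneg h] at hξ
    · left; rw [abs_of_neg h] at hξ; linarith
  -- on real points `G` is the canonical representative
  have hGreal : ∀ y : ℝ, G y = (ν : ℂ)⁻¹ * ∫ x in Icc (-1 : ℝ) 1, sincKernel (y - x) * (S : ℝ → ℂ) x := by
    intro y
    rw [hGdef]
    simp only []
    congr 1
    rw [integral_sincKernel_mul_eq, hF₁, ← integral_indicator measurableSet_Ioc]
    refine integral_congr_ae (Eventually.of_forall fun ξ => ?_)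
    simp only []
    by_cases hξ : ξ ∈ Ioc (-1 : ℝ) 1
    · rw [indicator_of_mem hξ, indicator_of_mem hξ]; congr 2; ring
    · rw [indicator_of_notMem hξ, indicator_of_notMem hξ, mul_zero]
  -- `S = G` a.e., the eigen-equation, evenness on `ℝ`
  have haeG : (S : ℝ → ℂ) =ᵐ[volume.restrict (Icc (-1 : ℝ) 1)] fun x : ℝ => G x := by
    have h1 := hK S
    rw [hS] at h1
    filter_upwards [h1, Lp.coeFn_smul (ν : ℂ) S] with y hy hy'
    rw [hGreal, ← hy, hy', Pi.smul_apply, smul_eq_mul, ← mul_assoc, inv_mul_cancel₀ hν', one_mul]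
  have hint_eq : ∀ y : ℝ, ∫ x in Icc (-1 : ℝ) 1, sincKernel (y - x) * G x =
      ∫ x in Icc (-1 : ℝ) 1, sincKernel (y - x) * (S : ℝ → ℂ) x := fun y => by
    refine integral_congr_ae ?_
    filter_upwards [haeG] with x hx
    rw [hx]
  have heqG : ∀ y ∈ Icc (-1 : ℝ) 1, (ν : ℂ) * G y = ∫ x in Icc (-1 : ℝ) 1, sincKernel (y - x) * G x := by
    intro y _
    rw [hint_eq, hGreal, ← mul_assoc, mul_inv_cancel₀ hν', one_mul]
  have hGeven : ∀ y : ℝ, G (-y) = G y := by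
    intro y
    rw [← Complex.ofReal_neg, hGreal, hGreal]
    congr 1
    have e2 := measurePreserving_neg_Icc.integral_comp (Homeomorph.neg ℝ).measurableEmbedding
      (fun u : ℝ => sincKernel (-y - u) * (S : ℝ → ℂ) u)
    rw [← e2]
    refine integral_congr_ae ?_
    filter_upwards [heven] with x hx
    show sincKernel (-y - -x) * (S : ℝ → ℂ) (-x) = sincKernel (y - x) * (S : ℝ → ℂ) x
    rw [hx, show -y - -x = -(y - x) by ring, sincKernel_neg]
  refine ⟨G, hGd, contDiff_restrict_of_differentiable hGd, hGeven, haeG, heqG, fun hS0 => ?_⟩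
  rcases eq_zero_or_finite_real_zeros hGd (-1) 1 with h0 | hfin
  · exfalso
    apply hS0
    refine Lp.ext ?_
    filter_upwards [haeG, Lp.coeFn_zero ℂ 2 (volume.restrict (Icc (-1 : ℝ) 1))] with x hx hx0
    rw [hx, hx0, Pi.zero_apply, h0]
  · exact hfin

/-- **Real and imaginary parts of eigenfunctions** (the kernel `κ` is real): if an entire `G` satisfies the
eigen-equation `νG(y) = ∫_{−1}^{1}κ(y−x)G(x)dx` on `[−1,1]`, so do `Re G|_ℝ` and `Im G|_ℝ` (as `ℂ`-valued
functions), and each of them is again the restriction of an entire function (`½(G(z) ± \overline{G(z̄)})`),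
hence vanishes identically on `ℝ` or has finitely many zeros in `[−1,1]`. [cite: SlepianPollak1961, §III (p. 45); ConnesConsani2021, §4 p. 16] -/
theorem re_im_of_entire_eigenfunction {G : ℂ → ℂ} (hG : Differentiable ℂ G) {ν : ℝ}
    (heq : ∀ y ∈ Icc (-1 : ℝ) 1, (ν : ℂ) * G y = ∫ x in Icc (-1 : ℝ) 1, sincKernel (y - x) * G x)
    (hGi : IntegrableOn (fun x : ℝ => G x) (Icc (-1 : ℝ) 1)) :
    (∀ y ∈ Icc (-1 : ℝ) 1, (ν : ℂ) * ((G y).re : ℂ) =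
        ∫ x in Icc (-1 : ℝ) 1, sincKernel (y - x) * ((G x).re : ℂ)) ∧
    (∀ y ∈ Icc (-1 : ℝ) 1, (ν : ℂ) * ((G y).im : ℂ) =
        ∫ x in Icc (-1 : ℝ) 1, sincKernel (y - x) * ((G x).im : ℂ)) ∧
    ContDiff ℝ (⊤ : ℕ∞) (fun x : ℝ => (G x).re) ∧ ContDiff ℝ (⊤ : ℕ∞) (fun x : ℝ => (G x).im) ∧
    ((∀ x : ℝ, (G x).re = 0) ∨ {x : ℝ | x ∈ Icc (-1 : ℝ) 1 ∧ (G x).re = 0}.Finite) ∧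
    ((∀ x : ℝ, (G x).im = 0) ∨ {x : ℝ | x ∈ Icc (-1 : ℝ) 1 ∧ (G x).im = 0}.Finite) := by
  -- the conjugate function satisfies the eigen-equation too (`κ` real)
  have hconj : ∀ y ∈ Icc (-1 : ℝ) 1, (ν : ℂ) * conj (G y) =
      ∫ x in Icc (-1 : ℝ) 1, sincKernel (y - x) * conj (G x) := by
    intro y hy
    have h := congrArg conj (heq y hy)
    rw [map_mul, Complex.conj_ofReal, ← integral_conj] at h
    rw [h]
    refine integral_congr_ae (Eventually.of_forall fun x => ?_)
    simp only [map_mul, conj_sincKernel]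
  -- real and imaginary parts as combinations
  have hre : ∀ w : ℂ, ((w.re : ℝ) : ℂ) = (w + conj w) / 2 := fun w => by
    rw [Complex.re_eq_add_conj]
  have him : ∀ w : ℂ, ((w.im : ℝ) : ℂ) = (w - conj w) / (2 * I) := fun w => by
    rw [Complex.im_eq_sub_conj]
  have hGc : IntegrableOn (fun x : ℝ => conj (G x)) (Icc (-1 : ℝ) 1) :=
    MeasureTheory.Integrable.mono hGi
      (RCLike.continuous_conj.comp_aestronglyMeasurable hGi.aestronglyMeasurable)
      (Eventually.of_forall fun x => by rw [RCLike.norm_conj])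
  have hk : ∀ y, ∀ f : ℝ → ℂ, IntegrableOn f (Icc (-1 : ℝ) 1) →
      Integrable (fun x => sincKernel (y - x) * f x) (volume.restrict (Icc (-1 : ℝ) 1)) :=
    fun y f hf => hf.bdd_mul (c := 2)
      (continuous_sincKernel.comp (continuous_const.sub continuous_id)).aestronglyMeasurable
      (Eventually.of_forall fun x => norm_sincKernel_le _)
  refine ⟨fun y hy => ?_, fun y hy => ?_, ?_, ?_, ?_, ?_⟩
  · simp_rw [hre]
    have e1 : ∫ x in Icc (-1 : ℝ) 1, sincKernel (y - x) * ((G x + conj (G x)) / 2) =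
        ((∫ x in Icc (-1 : ℝ) 1, sincKernel (y - x) * G x) +
          ∫ x in Icc (-1 : ℝ) 1, sincKernel (y - x) * conj (G x)) / 2 := by
      rw [← integral_add (hk y _ hGi) (hk y _ hGc), ← integral_div]
      refine integral_congr_ae (Eventually.of_forall fun x => ?_); simp only []; ring
    rw [e1, ← heq y hy, ← hconj y hy]; ring
  · simp_rw [him]
    have e1 : ∫ x in Icc (-1 : ℝ) 1, sincKernel (y - x) * ((G x - conj (G x)) / (2 * I)) =
        ((∫ x in Icc (-1 : ℝ) 1, sincKernel (y - x) * G x) -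
          ∫ x in Icc (-1 : ℝ) 1, sincKernel (y - x) * conj (G x)) / (2 * I) := by
      rw [← integral_sub (hk y _ hGi) (hk y _ hGc), ← integral_div]
      refine integral_congr_ae (Eventually.of_forall fun x => ?_); simp only []; ring
    rw [e1, ← heq y hy, ← hconj y hy]; ring
  · exact Complex.reCLM.contDiff.comp (contDiff_restrict_of_differentiable hG)
  · exact Complex.imCLM.contDiff.comp (contDiff_restrict_of_differentiable hG)
  · -- `Re G|_ℝ` is the restriction of the entire `z ↦ (G z + conj (G (conj z))) / 2`
    have hH : Differentiable ℂ fun z => (G z + conj (G (conj z))) / 2 := by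
      refine (hG.add fun z => ?_).div_const _
      have h := (hG (conj z)).conj_conj
      rw [Complex.conj_conj] at h
      exact h
    rcases eq_zero_or_finite_real_zeros hH (-1) 1 with h0 | hfin
    · left; intro x
      have h := h0 x
      rw [Complex.conj_ofReal, ← hre] at h
      exact_mod_cast h
    · right
      refine hfin.subset fun x hx => ⟨hx.1, ?_⟩
      show (G x + conj (G (conj (x : ℂ)))) / 2 = 0
      rw [Complex.conj_ofReal, ← hre, hx.2, Complex.ofReal_zero]
  · have hH : Differentiable ℂ fun z => (G z - conj (G (conj z))) / (2 * I) := by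
      refine (hG.sub fun z => ?_).div_const _
      have h := (hG (conj z)).conj_conj
      rw [Complex.conj_conj] at h
      exact h
    rcases eq_zero_or_finite_real_zeros hH (-1) 1 with h0 | hfin
    · left; intro x
      have h := h0 x
      rw [Complex.conj_ofReal, ← him] at h
      exact_mod_cast h
    · right
      refine hfin.subset fun x hx => ⟨hx.1, ?_⟩
      show (G x - conj (G (conj (x : ℂ)))) / (2 * I) = 0
      rw [Complex.conj_ofReal, ← him, hx.2, Complex.ofReal_zero]

end Entire

end Literature.NumberTheory.ConnesConsani2021
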